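import Summits.Ventures.PercRepro.SixFourT4Identity
import Summits.Ventures.PercRepro.SixFourT4Lpp

/-!
# PercRepro — C-025 at `(6,4)`: THE IDENTITY FOR `J₃` IN PLANE-LINE FORM (p2, gen 8 — mine-2 §21.11.2 / §21.18.9.5)

The `t = 3` analogue of Lemma 22.1 (`J_four_identity`): with `T₂ = #{Z ⊆ G : r(Z) ≤ 2} = S₂(g) + Σ_ℓ ε(m_ℓ)`
(`T2_eq`) and `DF₃ = T₂ − X₂`, `X₂ = #{Z : r(Z) ≤ 2, r(G ∖ Z) ≤ 3}` (`DF_three_add_X2`), §21.8's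
`J₃ = (9/5)N₄ + (6/5)DF₃ − (12/5)I₄ − (3/2)pp − 2·lpp` (`J_three_eq`) becomes

  `J₃ = F₃(g) − Σ_ρ cost₃_g(ρ) + Σ_ℓ bonus₃(m_ℓ) + lpp − (6/5)·X₂`     (`J_three_identity`)

with `F₃(g) = (9/5)(2^g − S₃(g)) + (6/5)S₂(g) − (12/5)C(g,4)`, `cost₃_g(ρ) = (9/5 + (3/2)(g − p))·D₃(ρ) − (12/5)·r₃(ρ,4)`,
`bonus₃(m) = (6/5)ε(m) − (9/5)δ(m) + (12/5)C(m,4)` — mine-2's `10·F₃ = F3_10`, `10·cost₃ = cost3_10`,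
`10·bonus₃ = bonus3_10` of §21.18.9.5.  Imports landed modules only.
-/

namespace PercRepro.SixFour

open Finset ThmH

variable {α : Type*} [DecidableEq α] {M : Matroid α} [M.Finite] {G : Finset α}

/-- `S₂(n) = 1 + n + C(n,2)`: the subsets with at most `2` elements of an `n`-set. -/
def S2 (n : ℕ) : ℕ := 1 + n + n.choose 2

/-- `T₂(G)`: the subsets of `G` of rank at most `2`. -/
noncomputable def T2cnt (M : Matroid α) [M.Finite] (G : Finset α) : ℕ :=
  (G.powerset.filter (fun Z : Finset α => M.eRk (Z : Set α) ≤ 2)).card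

/-- `X₂(G)`: the subsets of rank `≤ 2` whose complement has rank `≤ 3`. -/
noncomputable def X2cnt (M : Matroid α) [M.Finite] (G : Finset α) : ℕ :=
  (G.powerset.filter (fun Z : Finset α => M.eRk (Z : Set α) ≤ 2 ∧ M.eRk ((G \ Z : Finset α) : Set α) ≤ 3)).card

/-- `F₃(g) = (9/5)(2^g − S₃(g)) + (6/5)S₂(g) − (12/5)C(g,4)`. -/
def F3 (g : ℕ) : ℚ := 9 / 5 * ((2 : ℚ) ^ g - (S3 g : ℚ)) + 6 / 5 * (S2 g : ℚ) - 12 / 5 * (g.choose 4 : ℚ)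

/-- `cost₃_g(ρ) = (9/5 + (3/2)(g − p))·D₃(ρ) − (12/5)·r₃(ρ,4)`. -/
noncomputable def cost3 (M : Matroid α) [M.Finite] (G P : Finset α) : ℚ :=
  (9 / 5 + 3 / 2 * ((G.card : ℚ) - (P ∩ G).card)) * (D3 M G P : ℚ) - 12 / 5 * (r34 M G P : ℚ)

/-- `bonus₃(m) = (6/5)ε(m) − (9/5)δ(m) + (12/5)C(m,4)`. -/
def bonus3 (m : ℕ) : ℚ := 6 / 5 * (eps m : ℚ) - 9 / 5 * (delta m : ℚ) + 12 / 5 * (m.choose 4 : ℚ)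

omit [DecidableEq α] in
/-- The subsets with at most `2` elements of an `n`-set number `S₂(n)`. -/
theorem card_powerset_filter_card_le_two (T : Finset α) :
    (T.powerset.filter (fun Z : Finset α => Z.card ≤ 2)).card = S2 T.card := by
  rw [Finset.powerset_card_disjiUnion, Finset.filter_disjiUnion, Finset.card_disjiUnion]
  have hterm : ∀ i ∈ Finset.range (T.card + 1),
      ((T.powersetCard i).filter (fun Z : Finset α => Z.card ≤ 2)).card = if i ≤ 2 then T.card.choose i else 0 := by
    intro i _
    split_ifs with hi
    · rw [Finset.filter_true_of_mem, Finset.card_powersetCard]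
      intro Z hZ
      rw [(Finset.mem_powersetCard.1 hZ).2]
      exact hi
    · rw [Finset.card_eq_zero, Finset.filter_false_of_mem]
      intro Z hZ
      rw [(Finset.mem_powersetCard.1 hZ).2]
      exact hi
  rw [Finset.sum_congr rfl hterm]
  have h3 : ∀ n, ∑ i ∈ Finset.range (n + 1), (if i ≤ 2 then n.choose i else 0) = S2 n := by
    intro n
    unfold S2
    rcases Nat.lt_or_ge n 2 with h | h
    · interval_cases n <;> decide
    · obtain ⟨k, rfl⟩ : ∃ k, n = k + 2 := ⟨n - 2, by omega⟩
      rw [Finset.sum_range_succ' _ (k + 2)]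
      rw [Finset.sum_range_succ' _ (k + 1)]
      rw [Finset.sum_range_succ' _ k]
      rw [Finset.sum_eq_zero (fun i hi => by rw [Finset.mem_range] at hi; rw [if_neg (by omega)])]
      simp only [Nat.choose_zero_right]
      norm_num
      ring
  exact h3 T.card

/-- The rank-`2` sets with `≥ 3` points whose closure is the line `L` are exactly the `≥ 3`-subsets of `L ∩ G`. -/
theorem fiber_line_eq3 (hs : Simple M) (hG : G ⊆ gr M) {L : Finset α} (hL : L ∈ lines M) :
    (G.powerset.filter (fun Z : Finset α => 3 ≤ Z.card ∧ M.eRk (Z : Set α) = 2)).filter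
      (fun Z : Finset α => clF M Z = L) =
      (L ∩ G).powerset.filter (fun S : Finset α => 3 ≤ S.card) := by
  ext Z
  simp only [Finset.mem_filter, Finset.mem_powerset]
  constructor
  · rintro ⟨⟨hZG, h3, -⟩, hcl⟩
    refine ⟨Finset.subset_inter ?_ hZG, h3⟩
    rw [← hcl, ← Finset.coe_subset, coe_clF]
    exact M.subset_closure _ (by rw [← coe_gr M]; exact Finset.coe_subset.2 (hZG.trans hG))
  · rintro ⟨hZ, h3⟩
    have hr := eRk_eq_two_of_subset_line hs hL (hZ.trans Finset.inter_subset_left) (by omega)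
    refine ⟨⟨hZ.trans Finset.inter_subset_right, h3, hr⟩, ?_⟩
    apply Finset.coe_injective
    rw [coe_clF]
    exact closure_eq_of_subset_line hL (hZ.trans Finset.inter_subset_left) hr

/-- `T₂ = S₂(g) + Σ_ℓ ε(m_ℓ)`. -/
theorem T2_eq (hs : Simple M) (hG : G ⊆ gr M) : T2cnt M G = S2 G.card + ∑ L ∈ lines M, eps (L ∩ G).card := by
  unfold T2cnt
  have h1 := Finset.card_filter_add_card_filter_not
    (s := G.powerset.filter (fun Z : Finset α => M.eRk (Z : Set α) ≤ 2)) (fun Z : Finset α => Z.card ≤ 2)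
  rw [Finset.filter_filter, Finset.filter_filter] at h1
  have e1 : G.powerset.filter (fun Z : Finset α => M.eRk (Z : Set α) ≤ 2 ∧ Z.card ≤ 2) =
      G.powerset.filter (fun Z : Finset α => Z.card ≤ 2) := by
    refine Finset.filter_congr (fun Z _ => ⟨fun h => h.2, fun h => ⟨?_, h⟩⟩)
    have := M.eRk_le_encard (Z : Set α)
    rw [Set.encard_coe_eq_coe_finsetCard] at this
    exact this.trans (by exact_mod_cast h)
  rw [e1, card_powerset_filter_card_le_two] at h1
  have e2 : G.powerset.filter (fun Z : Finset α => M.eRk (Z : Set α) ≤ 2 ∧ ¬ Z.card ≤ 2) =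
      G.powerset.filter (fun Z : Finset α => 3 ≤ Z.card ∧ M.eRk (Z : Set α) = 2) := by
    refine Finset.filter_congr (fun Z hZ => ?_)
    rw [Finset.mem_powerset] at hZ
    constructor
    · rintro ⟨h2, hc⟩
      exact ⟨by omega, le_antisymm h2 (two_le_eRk_of_two_le_card hs hG hZ (by omega))⟩
    · rintro ⟨hc, hr2⟩
      exact ⟨hr2.le, by omega⟩
  rw [e2] at h1
  have hln : (G.powerset.filter (fun Z : Finset α => 3 ≤ Z.card ∧ M.eRk (Z : Set α) = 2)).card =
      ∑ L ∈ lines M, eps (L ∩ G).card := by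
    rw [Finset.card_eq_sum_card_fiberwise (f := fun Z => clF M Z) (t := lines M) (fun Z hZ => by
      rw [Finset.mem_coe, Finset.mem_filter, Finset.mem_powerset] at hZ
      exact Finset.mem_coe.2 (clF_mem_lines (hZ.1.trans hG) hZ.2.2).1)]
    exact Finset.sum_congr rfl (fun L hL => by rw [fiber_line_eq3 hs hG hL, card_powerset_filter_three_le])
  omega

/-- `DF₃ + X₂ = T₂`: `B′ ↦ G ∖ B′` maps the demand-free sets at `t = 3` onto the rank-`≤ 2` sets whose complement
has rank `4`. -/
theorem DF_three_add_X2 (hr : M.eRk (G : Set α) = 4) : DF M G 3 + X2cnt M G = T2cnt M G := by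
  have hsplit := Finset.card_filter_add_card_filter_not
    (s := G.powerset.filter (fun Z : Finset α => M.eRk (Z : Set α) ≤ 2))
    (fun Z : Finset α => M.eRk ((G \ Z : Finset α) : Set α) ≤ 3)
  rw [Finset.filter_filter, Finset.filter_filter] at hsplit
  have hX : X2cnt M G = (G.powerset.filter (fun Z : Finset α => M.eRk (Z : Set α) ≤ 2 ∧
      M.eRk ((G \ Z : Finset α) : Set α) ≤ 3)).card := rfl
  unfold T2cnt
  rw [← hsplit, ← hX, add_comm]
  congr 1
  unfold DF
  refine Finset.card_nbij' (fun B => G \ B) (fun Z => G \ Z) ?_ ?_ ?_ ?_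
  · intro B hB
    rw [Finset.coe_filter] at hB
    obtain ⟨hB4, hdf⟩ := hB
    obtain ⟨hBG, hB4⟩ := mem_R4.1 hB4
    rw [Finset.mem_coe, Finset.mem_filter, Finset.mem_powerset]
    refine ⟨Finset.sdiff_subset, ?_, ?_⟩
    · have : M.eRk ((G \ B : Finset α) : Set α) + 1 ≤ ((3 : ℕ) : ℕ∞) := hdf
      obtain ⟨k, hk, -⟩ := eRk_eq_nat M (G \ B)
      rw [hk] at this ⊢
      have h1 : k + 1 ≤ 3 := by exact_mod_cast this
      exact_mod_cast (by omega : k ≤ 2)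
    · rw [Finset.sdiff_sdiff_eq_self hBG, hB4]
      decide
  · intro Z hZ
    rw [Finset.mem_coe, Finset.mem_filter, Finset.mem_powerset] at hZ
    obtain ⟨hZG, hZ2, hZc⟩ := hZ
    rw [Finset.mem_coe, Finset.mem_filter, mem_R4]
    refine ⟨⟨Finset.sdiff_subset, ?_⟩, ?_⟩
    · have hle : M.eRk ((G \ Z : Finset α) : Set α) ≤ 4 := by
        rw [← hr]; exact M.eRk_mono (Finset.coe_subset.2 Finset.sdiff_subset)
      exact eRk_eq_of_le_of_not_le (n := 3) hle hZc
    · rw [Finset.sdiff_sdiff_eq_self hZG]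
      obtain ⟨k, hk, -⟩ := eRk_eq_nat M Z
      rw [hk] at hZ2 ⊢
      have h2 : k ≤ 2 := by exact_mod_cast hZ2
      have : ((k : ℕ) : ℕ∞) + 1 ≤ ((3 : ℕ) : ℕ∞) := by exact_mod_cast (by omega : k + 1 ≤ 3)
      exact this
  · intro B hB
    rw [Finset.coe_filter] at hB
    exact Finset.sdiff_sdiff_eq_self (mem_R4.1 hB.1).1
  · intro Z hZ
    rw [Finset.coe_filter] at hZ
    exact Finset.sdiff_sdiff_eq_self (Finset.mem_powerset.1 hZ.1)

/-- **The identity for `J₃`** (§21.11.2): `J₃ = F₃(g) − Σ_ρ cost₃_g(ρ) + Σ_ℓ bonus₃(m_ℓ) + lpp − (6/5)·X₂`. -/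
theorem J_three_identity (hs : Simple M) (hG : G ⊆ gr M) (hr : M.eRk (G : Set α) = 4) :
    J M G 3 = F3 G.card - ∑ P ∈ planes M, cost3 M G P + ∑ L ∈ lines M, bonus3 (L ∩ G).card +
      (lpp M G : ℚ) - 6 / 5 * (X2cnt M G : ℚ) := by
  rw [J_three_eq hs hG]
  have h1 : (N4 M G : ℚ) + T3cnt M G = (2 : ℚ) ^ G.card := by exact_mod_cast N4_add_T3 hr
  have h2 : (DF M G 3 : ℚ) + X2cnt M G = T2cnt M G := by exact_mod_cast DF_three_add_X2 hr
  have h3 : (T3cnt M G : ℚ) = S3 G.card + ∑ P ∈ planes M, (D3 M G P : ℚ) + ∑ L ∈ lines M, (delta (L ∩ G).card : ℚ) := by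
    have := T3_eq hs hG
    exact_mod_cast this
  have h4 : (I4 M G : ℚ) + ∑ P ∈ planes M, (r34 M G P : ℚ) + ∑ L ∈ lines M, ((L ∩ G).card.choose 4 : ℚ) =
      (G.card.choose 4 : ℚ) := by
    have := I4_eq hs hG hr
    exact_mod_cast this
  have h5 : (pp M G : ℚ) + 2 * lpp M G = ∑ P ∈ planes M, ((G.card : ℚ) - (P ∩ G).card) * (D3 M G P : ℚ) := by
    have := pp_add_two_lpp_eq hs hG
    have hc : ∀ P ∈ planes M, ((G.card - (P ∩ G).card : ℕ) : ℚ) = (G.card : ℚ) - (P ∩ G).card := by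
      intro P _
      exact Nat.cast_sub (Finset.card_le_card Finset.inter_subset_right)
    rw [← Finset.sum_congr rfl (fun P hP => by rw [← hc P hP])]
    exact_mod_cast this
  have h6 : (T2cnt M G : ℚ) = S2 G.card + ∑ L ∈ lines M, (eps (L ∩ G).card : ℚ) := by
    have := T2_eq hs hG
    exact_mod_cast this
  have hcost : ∑ P ∈ planes M, cost3 M G P =
      9 / 5 * ∑ P ∈ planes M, (D3 M G P : ℚ) + 3 / 2 * ∑ P ∈ planes M, ((G.card : ℚ) - (P ∩ G).card) * (D3 M G P : ℚ) -
        12 / 5 * ∑ P ∈ planes M, (r34 M G P : ℚ) := by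
    rw [Finset.mul_sum, Finset.mul_sum, Finset.mul_sum, ← Finset.sum_add_distrib, ← Finset.sum_sub_distrib]
    refine Finset.sum_congr rfl (fun P _ => ?_)
    unfold cost3
    ring
  have hbonus : ∑ L ∈ lines M, bonus3 (L ∩ G).card =
      6 / 5 * ∑ L ∈ lines M, (eps (L ∩ G).card : ℚ) - 9 / 5 * ∑ L ∈ lines M, (delta (L ∩ G).card : ℚ) +
        12 / 5 * ∑ L ∈ lines M, ((L ∩ G).card.choose 4 : ℚ) := by
    rw [Finset.mul_sum, Finset.mul_sum, Finset.mul_sum, ← Finset.sum_sub_distrib, ← Finset.sum_add_distrib]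
    rfl
  rw [hcost, hbonus]
  unfold F3
  linarith

end PercRepro.SixFour
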